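import Summits.QuantumFields.YangMills.Theorems.UnitScaleTiltProp7CovariantPlaquetteExpansion
import Summits.QuantumFields.YangMills.Theorems.UnitScaleTiltProp7FlatLocalMinimality
import HarnessLib

/-!
# Route `UnitScaleTilt`, crux K1 child «MinimiserStabilityRegPr» (stmt-QuantumFields-19200), registered stub `stub_prop7From14` (v4 828f5fb4a904d3be;
# leaf V3 «Prop 7 from a background (14)» = `T3Thm1CarrierNative.Prop7From14At`) — sub-lemma V3-B∕F at a NON-FLAT background, part 1/2: HILBERT–SCHMIDT
# BOOKKEEPING FOR THE WILSON ACTION AT A BACKGROUND (polarization, unitary invariance, `|Re Tr M| ≤ N‖M‖`, the abstract expansion inequality, the `SU(2)`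
# action as `¼Σ_p‖U(∂p) − 1‖²_HS`, plaquette sums, and the curvature defect of the exact linear part against the covariant curl)

Cell `ym3-torus` ∕ fleet seat `ym-ust-19200-p1` (HUMAN RULING D-0037, YM ladder rung R3), successor g2.  WHERE THIS SITS.  [Balaban1985Variational] (26)–(31):
`A(U′U₀) = A(U₀) + ⟨J(U₀), A⟩ + ½⟨A, Δ(U₀)A⟩ + …`; (141)–(143): at the critical point the second-order term is positive by [Balaban1985BackgroundPropagators]
Thm 3.11, «hence A′ = 0 is a minimum».  For `SU(2)` the Wilson action is EXACTLY a Hilbert–Schmidt square, `A(U) = ¼Σ_p Σ_{jk}|(U(∂p) − 1)_{jk}|²` (tree: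
(0.14) findings of `MatrixNorms`), so the expansion around a background `U₀` is the polarization of `‖E + G‖²_HS` with `E = U₀(∂p) − 1` and `G = U(∂p) − U₀(∂p)
= (L + r)·U₀(∂p)` (`L` the exact linear part of `UnitScaleTiltProp7CovariantPlaquetteExpansion`, `r` its second-order remainder).  This file supplies that
bookkeeping; the sequel `UnitScaleTiltProp7CovariantLocalMinimality` composes it with the small-field Thm 3.11 (`UnitScaleTiltProp7SmallFieldThm311`).

WHAT IS PROVED (sorry-free, no definition; our own statements — [folklore] ∕ cited to the printed step they instantiate):
* §3 `sum_norm_sq_add_eq` (polarization `Σ|(E+G)_jk|² = Σ|E_jk|² + 2Re Tr(E^*G) + Σ|G_jk|²`), `sum_norm_sq_mul_unitary` (right unitary invariance), `abs_re_trace_le`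
  (`|Re Tr M| ≤ N‖M‖`), `sum_norm_sq_sub_le`, and **`sum_norm_sq_expansion_ge`**: for unitary `P₀`,
  `Σ|(E + (L + r)P₀)_jk|² ≥ Σ|E_jk|² + 2Re Tr(E^*LP₀) + ¼Σ|F_jk|² − ½Σ|(L − F)_jk|² − Σ|r_jk|² − 2N‖E‖‖r‖` (any `F`);
* §4 `sum_norm_sq_coe_sub_one_su2` (`Σ|(g − 1)_jk|² = 2‖g − 1‖²` on `SU(2)`), **`wilsonAction4_eq_quarter_sum_hs`** (`A(U) = ¼Σ_pΣ_{jk}|(U(∂p) − 1)_jk|²`),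
  `sum_plaq_eq_sum_ite` (`Σ_{p} G(p) = Σ_xΣ_μΣ_ν [μ<ν] G(x,μ,ν)`), and **`norm_lin_sub_curl_le`**: with `Q = V₁V₂V₃⁻¹ = P₀V₄`,
  `‖(QY₃Q^* + P₀Y₄P₀^*) − (V₄Y₃V₄^* + Y₄)‖ ≤ 2‖P₀ − 1‖(‖Y₃‖ + ‖Y₄‖)` — the exact linear part is the covariant curl up to the background curvature.

References: T. Bałaban, CMP 102 (1985) 277–309 [Balaban1985Variational] ((26)–(31) pp.282–283, (141)–(143) p.299); CMP 99 (1985) 389–434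
[Balaban1985BackgroundPropagators] ((3.1)–(3.4) pp.390–391, Thm 3.11 p.416); CMP 109 (1987) 249–301 [Balaban1987RG1] ((0.14) p.254).
-/

noncomputable section

open scoped BigOperators Matrix.Norms.L2Operator Matrix

namespace Summit.QuantumFields.YangMills.Theorems.Prop7CovariantCoercivity

open Literature.MathematicalPhysics.QuantumFieldTheory.Balaban1983to89
open Finset B1RG242Torus
open B9Eq39Adjoint (R R_def covD curl)
open B7Eq78Linearization (conjR)
open B10Eq27TorusAxialLog (unitsField toUField unitsField_mem_unitaryUnits val_unitsField)
open B9TorusCalculus (torusT torusT_apply)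
open Summit.QuantumFields.YangMills.Theorems.Prop7FlatExpansion (norm_plaq_sub_one_sub_lin_le coe_plaqHol)
open Summit.QuantumFields.YangMills.Theorems.AvgCurvGrad (norm_coe_su norm_coe_conj_sub_conj)

variable {n : Type*} [Fintype n] [DecidableEq n]

/-! ## §3 Hilbert–Schmidt bookkeeping for the action at a background -/

section HS

variable {N : ℕ}

/-- Polarization: `Σ|(E + G)_jk|² = Σ|E_jk|² + 2Re Tr(E^*G) + Σ|G_jk|²`. [folklore] -/
theorem sum_norm_sq_add_eq (E G : Matrix (Fin N) (Fin N) ℂ) :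
    ∑ j : Fin N, ∑ k : Fin N, ‖(E + G) j k‖ ^ 2
      = ∑ j : Fin N, ∑ k : Fin N, ‖E j k‖ ^ 2 + 2 * ((Eᴴ * G).trace).re + ∑ j : Fin N, ∑ k : Fin N, ‖G j k‖ ^ 2 := by
  rw [re_trace_conjTranspose_mul, Finset.mul_sum, ← Finset.sum_add_distrib, ← Finset.sum_add_distrib]
  refine Finset.sum_congr rfl fun j _ => ?_
  rw [Finset.mul_sum, ← Finset.sum_add_distrib, ← Finset.sum_add_distrib]
  refine Finset.sum_congr rfl fun k _ => ?_
  rw [Matrix.add_apply, Complex.sq_norm, Complex.sq_norm, Complex.sq_norm, Complex.normSq_apply, Complex.normSq_apply, Complex.normSq_apply,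
    Complex.add_re, Complex.add_im]
  ring

/-- Right multiplication by a unitary preserves `Σ|X_jk|²`. [folklore] -/
theorem sum_norm_sq_mul_unitary (D : Matrix (Fin N) (Fin N) ℂ) {P₀ : Matrix (Fin N) (Fin N) ℂ} (hP : P₀ ∈ Matrix.unitaryGroup (Fin N) ℂ) :
    ∑ j : Fin N, ∑ k : Fin N, ‖(D * P₀) j k‖ ^ 2 = ∑ j : Fin N, ∑ k : Fin N, ‖D j k‖ ^ 2 := by
  rw [← re_trace_conjTranspose_mul_self, ← re_trace_conjTranspose_mul_self, Matrix.conjTranspose_mul]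
  have h : P₀ * P₀ᴴ = 1 := by
    have := Matrix.mem_unitaryGroup_iff.mp hP
    rwa [Matrix.star_eq_conjTranspose] at this
  rw [show P₀ᴴ * Dᴴ * (D * P₀) = P₀ᴴ * (Dᴴ * D * P₀) by noncomm_ring, Matrix.trace_mul_comm, show Dᴴ * D * P₀ * P₀ᴴ = Dᴴ * D * (P₀ * P₀ᴴ) by noncomm_ring,
    h, mul_one]

/-- `|Re Tr M| ≤ N‖M‖` (tree `MatrixNorms.norm_ntr_le_opNorm`). [folklore] -/
theorem abs_re_trace_le (M : Matrix (Fin N) (Fin N) ℂ) : |(M.trace).re| ≤ N * ‖M‖ := by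
  rcases Nat.eq_zero_or_pos N with hN | hN
  · subst hN
    simp [Matrix.trace]
  have h := MatrixNorms.norm_ntr_le_opNorm M
  rw [MatrixNorms.ntr, norm_div, Fintype.card_fin] at h
  have hN' : (0 : ℝ) < N := by exact_mod_cast hN
  rw [show ‖(N : ℂ)‖ = (N : ℝ) by simp, div_le_iff₀ hN'] at h
  exact (Complex.abs_re_le_norm _).trans (by linarith)

/-- `Σ|(A − B)_jk|² ≤ 2Σ|A_jk|² + 2Σ|B_jk|²`. [folklore] -/
theorem sum_norm_sq_sub_le (A B : Matrix (Fin N) (Fin N) ℂ) :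
    ∑ j : Fin N, ∑ k : Fin N, ‖(A - B) j k‖ ^ 2 ≤ 2 * ∑ j : Fin N, ∑ k : Fin N, ‖A j k‖ ^ 2 + 2 * ∑ j : Fin N, ∑ k : Fin N, ‖B j k‖ ^ 2 := by
  have h := sum_norm_sq_add_le A (-B)
  simp only [Matrix.neg_apply, norm_neg] at h
  rwa [← sub_eq_add_neg] at h

/-- **THE HILBERT–SCHMIDT EXPANSION OF THE PLAQUETTE DEVIATION AT A BACKGROUND** (abstract bookkeeping behind (26)–(31) of [Balaban1985Variational]): if
`X = E + (L + r)P₀` with `P₀` unitary (`X = U(∂p) − 1`, `E = U₀(∂p) − 1`, `L` the exact linear part, `r` the second-order remainder) and `F` is any matrix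
(the covariant curl), then
`Σ|X_jk|² ≥ Σ|E_jk|² + 2Re Tr(E^*LP₀) + ¼Σ|F_jk|² − ½Σ|(L − F)_jk|² − Σ|r_jk|² − 2N‖E‖‖r‖`. [cite: Balaban1985Variational, (26)-(31) pp.282-283] -/
theorem sum_norm_sq_expansion_ge [NeZero N] {E L r F P₀ : Matrix (Fin N) (Fin N) ℂ} (hP : P₀ ∈ Matrix.unitaryGroup (Fin N) ℂ) :
    ∑ j : Fin N, ∑ k : Fin N, ‖E j k‖ ^ 2 + 2 * ((Eᴴ * (L * P₀)).trace).re
        + (1 / 4) * ∑ j : Fin N, ∑ k : Fin N, ‖F j k‖ ^ 2 - (1 / 2) * ∑ j : Fin N, ∑ k : Fin N, ‖(L - F) j k‖ ^ 2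
        - ∑ j : Fin N, ∑ k : Fin N, ‖r j k‖ ^ 2 - 2 * N * ‖E‖ * ‖r‖
      ≤ ∑ j : Fin N, ∑ k : Fin N, ‖(E + (L + r) * P₀) j k‖ ^ 2 := by
  rw [sum_norm_sq_add_eq, sum_norm_sq_mul_unitary _ hP]
  -- the pairing term
  have h1 : ((Eᴴ * ((L + r) * P₀)).trace).re = ((Eᴴ * (L * P₀)).trace).re + ((Eᴴ * (r * P₀)).trace).re := by
    rw [add_mul, mul_add, Matrix.trace_add, Complex.add_re]
  have h2 : |((Eᴴ * (r * P₀)).trace).re| ≤ N * ‖E‖ * ‖r‖ := by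
    refine (abs_re_trace_le _).trans ?_
    have hP1 : ‖P₀‖ ≤ 1 := (UnitaryModel.norm_of_mem_unitaryGroup hP).le
    have : ‖Eᴴ * (r * P₀)‖ ≤ ‖E‖ * ‖r‖ := by
      calc ‖Eᴴ * (r * P₀)‖ ≤ ‖Eᴴ‖ * (‖r‖ * ‖P₀‖) := (norm_mul_le _ _).trans (mul_le_mul_of_nonneg_left (norm_mul_le _ _) (norm_nonneg _))
        _ ≤ ‖E‖ * (‖r‖ * 1) := by
            rw [← Matrix.star_eq_conjTranspose, norm_star]
            gcongr
        _ = ‖E‖ * ‖r‖ := by ring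
    have hN : (0 : ℝ) ≤ N := Nat.cast_nonneg _
    nlinarith [this]
  -- the quadratic term
  have h3 : ∑ j : Fin N, ∑ k : Fin N, ‖L j k‖ ^ 2 ≤ 2 * ∑ j : Fin N, ∑ k : Fin N, ‖(L + r) j k‖ ^ 2 + 2 * ∑ j : Fin N, ∑ k : Fin N, ‖r j k‖ ^ 2 := by
    have := sum_norm_sq_sub_le (L + r) r
    rwa [add_sub_cancel_right] at this
  have h4 : ∑ j : Fin N, ∑ k : Fin N, ‖F j k‖ ^ 2 ≤ 2 * ∑ j : Fin N, ∑ k : Fin N, ‖L j k‖ ^ 2 + 2 * ∑ j : Fin N, ∑ k : Fin N, ‖(L - F) j k‖ ^ 2 := by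
    have := sum_norm_sq_sub_le L (L - F)
    rwa [sub_sub_cancel] at this
  have h5 := (abs_le.mp h2).1
  rw [h1]
  linarith

end HS


/-! ## §4 The `SU(2)` Wilson action in Hilbert–Schmidt form, plaquette sums, and the linear part against the covariant curl -/

section Action

open B10StarCount (sum_pbond)
open B10Eq27TorusAxialLog (holT unitsField toUField unitsField_mem_unitaryUnits)
open B7Prop1Explicit (treeWord)
open B9Eq39Adjoint (divB)
open Summit.QuantumFields.YangMills.Theorems.Prop7FlatExpansion (wilsonAction4_eq_half_sum_norm_sq)
open Summit.QuantumFields.YangMills.Theorems.Prop7FlatLocalMin (sum_plaq_bonds_le)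

/-- On `SU(2)`: `Σ_{jk}|(g − 1)_jk|² = 2‖g − 1‖²` (the tree's (0.14) findings: `nhsNormSq_sub_one_of_mem_unitaryGroup`, `opDist1_sq_eq_of_mem_specialUnitaryGroup_two`).
[cite: Balaban1987RG1, (0.14) p.254] -/
theorem sum_norm_sq_coe_sub_one_su2 (g : Matrix.specialUnitaryGroup (Fin 2) ℂ) :
    ∑ j : Fin 2, ∑ k : Fin 2, ‖((g : Matrix (Fin 2) (Fin 2) ℂ) - 1) j k‖ ^ 2 = 2 * ‖(g : Matrix (Fin 2) (Fin 2) ℂ) - 1‖ ^ 2 := by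
  have h1 := MatrixNorms.nhsNormSq_sub_one_of_mem_unitaryGroup (n := Fin 2) g.2.1
  have h2 := MatrixNorms.opDist1_sq_eq_of_mem_specialUnitaryGroup_two g.2
  have h3 := MatrixNorms.card_mul_nhsNormSq ((g : Matrix (Fin 2) (Fin 2) ℂ) - 1)
  rw [Fintype.card_fin] at h3
  rw [UnitaryModel.opDist1] at h2
  rw [← h3, h1, ← h2]
  push_cast
  ring

variable {P : Params} {j : ℕ}

/-- **THE `SU(2)` WILSON ACTION IN HILBERT–SCHMIDT FORM**: `A(U) = ¼·Σ_p Σ_{jk}|(U(∂p) − 1)_jk|²`. [cite: Balaban1987RG1, (0.14) p.254] -/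
theorem wilsonAction4_eq_quarter_sum_hs (U : GaugeField P j (Matrix.specialUnitaryGroup (Fin 2) ℂ)) :
    wilsonAction4 U = ∑ p : Plaq P j, (1 / 4) * ∑ i₁ : Fin 2, ∑ i₂ : Fin 2,
      ‖(((GaugeField.plaqHol U p : Matrix.specialUnitaryGroup (Fin 2) ℂ) : Matrix (Fin 2) (Fin 2) ℂ) - 1) i₁ i₂‖ ^ 2 := by
  rw [wilsonAction4_eq_half_sum_norm_sq]
  refine Finset.sum_congr rfl fun p _ => ?_
  rw [sum_norm_sq_coe_sub_one_su2]
  ring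

/-- A sum over the positively oriented plaquettes is the `μ < ν` part of the sum over all triples `(x, μ, ν)`. [folklore] -/
theorem sum_plaq_eq_sum_ite (G : Site P j → Fin P.d → Fin P.d → ℝ) :
    ∑ p : Plaq P j, G p.src p.μ p.ν = ∑ x : Site P j, ∑ μ : Fin P.d, ∑ ν : Fin P.d, (if μ < ν then G x μ ν else 0) := by
  classical
  set ι : Plaq P j → Site P j × Fin P.d × Fin P.d := fun p => (p.src, p.μ, p.ν) with hι
  have hinj : Set.InjOn ι (univ : Finset (Plaq P j)) := by
    rintro ⟨x, μ, ν, h⟩ _ ⟨x', μ', ν', h'⟩ _ hpq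
    simp only [hι, Prod.mk.injEq] at hpq
    obtain ⟨rfl, rfl, rfl⟩ := hpq
    rfl
  have himage : (univ : Finset (Plaq P j)).image ι = univ.filter (fun t : Site P j × Fin P.d × Fin P.d => t.2.1 < t.2.2) := by
    ext t
    simp only [Finset.mem_image, Finset.mem_univ, true_and, Finset.mem_filter, hι]
    constructor
    · rintro ⟨p, rfl⟩; exact p.hμν
    · intro ht; exact ⟨⟨t.1, t.2.1, t.2.2, ht⟩, rfl⟩
  have h1 : ∑ p : Plaq P j, G p.src p.μ p.ν = ∑ t ∈ (univ : Finset (Plaq P j)).image ι, G t.1 t.2.1 t.2.2 := by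
    rw [Finset.sum_image hinj]
  rw [h1, himage, Finset.sum_filter, Fintype.sum_prod_type]
  exact Finset.sum_congr rfl fun x _ => Fintype.sum_prod_type _

/-- The exact linear part and the covariant curl differ by the curvature of the background: with `Q = V₁V₂V₃⁻¹ = P₀V₄`,
`‖(QY₃Q^* + P₀Y₄P₀^*) − (V₄Y₃V₄^* + Y₄)‖ ≤ 2‖P₀ − 1‖(‖Y₃‖ + ‖Y₄‖)`. [cite: Balaban1985Variational, (28) p.282] -/
theorem norm_lin_sub_curl_le {n : Type*} [Fintype n] [DecidableEq n] (V₁ V₂ V₃ V₄ : Matrix.specialUnitaryGroup n ℂ) (Y₃ Y₄ : Matrix n n ℂ) :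
    ‖(((V₁ * V₂ * V₃⁻¹ : Matrix.specialUnitaryGroup n ℂ) : Matrix n n ℂ) * Y₃ * star ((V₁ * V₂ * V₃⁻¹ : Matrix.specialUnitaryGroup n ℂ) : Matrix n n ℂ)
        + ((V₁ * V₂ * V₃⁻¹ * V₄⁻¹ : Matrix.specialUnitaryGroup n ℂ) : Matrix n n ℂ) * Y₄ * star ((V₁ * V₂ * V₃⁻¹ * V₄⁻¹ : Matrix.specialUnitaryGroup n ℂ) : Matrix n n ℂ))
      - ((V₄ : Matrix n n ℂ) * Y₃ * star (V₄ : Matrix n n ℂ) + Y₄)‖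
      ≤ 2 * ‖((V₁ * V₂ * V₃⁻¹ * V₄⁻¹ : Matrix.specialUnitaryGroup n ℂ) : Matrix n n ℂ) - 1‖ * (‖Y₃‖ + ‖Y₄‖) := by
  set P₀ : Matrix.specialUnitaryGroup n ℂ := V₁ * V₂ * V₃⁻¹ * V₄⁻¹ with hP₀
  have hQ : (V₁ * V₂ * V₃⁻¹ : Matrix.specialUnitaryGroup n ℂ) = P₀ * V₄ := by rw [hP₀]; group
  rw [hQ, Submonoid.coe_mul, star_mul]
  have e : (P₀ : Matrix n n ℂ) * (V₄ : Matrix n n ℂ) * Y₃ * (star (V₄ : Matrix n n ℂ) * star (P₀ : Matrix n n ℂ))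
        + (P₀ : Matrix n n ℂ) * Y₄ * star (P₀ : Matrix n n ℂ) - ((V₄ : Matrix n n ℂ) * Y₃ * star (V₄ : Matrix n n ℂ) + Y₄)
      = ((P₀ : Matrix n n ℂ) * ((V₄ : Matrix n n ℂ) * Y₃ * star (V₄ : Matrix n n ℂ)) * star (P₀ : Matrix n n ℂ) - (V₄ : Matrix n n ℂ) * Y₃ * star (V₄ : Matrix n n ℂ))
        + ((P₀ : Matrix n n ℂ) * Y₄ * star (P₀ : Matrix n n ℂ) - Y₄) := by noncomm_ring
  rw [e]
  have hV : (V₄ : Matrix n n ℂ) ∈ Matrix.unitaryGroup n ℂ := V₄.2.1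
  have n3 : ‖(V₄ : Matrix n n ℂ) * Y₃ * star (V₄ : Matrix n n ℂ)‖ = ‖Y₃‖ := by
    rw [CStarRing.norm_mul_mem_unitary _ (Unitary.star_mem hV), CStarRing.norm_mem_unitary_mul _ hV]
  have r₃ := norm_conj_sub_self_le' P₀ ((V₄ : Matrix n n ℂ) * Y₃ * star (V₄ : Matrix n n ℂ))
  rw [n3] at r₃
  have r₄ := norm_conj_sub_self_le' P₀ Y₄
  calc _ ≤ _ := norm_add_le _ _
    _ ≤ _ := add_le_add r₃ r₄
    _ = _ := by ring

end Action

end Summit.QuantumFields.YangMills.Theorems.Prop7CovariantCoercivity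

end
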